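import Summits.BirchSwinnertonDyer.BirchSwinnertonDyer.Theorems.KimAtThreeFineKatoKPortUnramified
import Summits.BirchSwinnertonDyer.Rank1Residual.Additive.LocalLogImageRat
import Literature.NumberTheory.EllipticCurves.ReductionHomomorphismCuspNodeProofs
import Literature.NumberTheory.EllipticCurves.GoodReductionLangLift
import HarnessLib

/-!
# K-PORT glue (G5): reduction at an ADDITIVE prime over a complete ultrametric `K ⊇ ℚ_p` in the
# `BallEval.curveK` currency — `E₀(K)`, `E₁(K) = FormalGroupChart.kernel`, **`p • E₀(K) ⊆ E₁(K)`**, hence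
# `E₀(K) ⊆ Ẽ₁(K)` and, for unramified `K`, **`‖Λ̃(Q)‖ ≤ 1` on `E₀(K)`** (SAT₀'s `log(E₀(K)) ⊆ 𝒪_K`)
# (cell `bsd-addord`, seat w2-kport gen 0; `--supports stmt-BirchSwinnertonDyer-19560`, helper)

HONEST FRAMING. Route W2 (`route-BirchSwinnertonDyer-KimAtThreeKolyvagin`), crux 19560
`KatoKuriharaPortThreeShared`, residual ⟨C1⟩ clause (C1.c) = SAT₀'s E-side (kim3 brief KIM3-KPORT-BRIEF-g12
§1 (E-K1) "`log_ω(E₀(K)) ⊆ 𝒪_K` by `3E₀ ⊆ E₁`", §3 (P3) "reduction: `E₀(K) →+ k` … with kernel `E₁(K)` at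
additive reduction"). The reduction theory for an ARBITRARY valuation ring is the tree's
`ReductionHomomorphism*` (`nonsingularReductionSubgroup` = `E₀`, `ReducesToZero` = `E₁`,
`exists_addMonoidHom_residueField_of_cusp`: at a cusp `E₀(K)/E₁(K) ↪ k̄⁺`); the x1b curve
`BallEval.curveK p K M` is DEFINITIONALLY `(M.map (BallEval.coeffHom p K)).baseChange K` for the
`𝒪_K`-model `M.map coeffHom`, and `FormalGroupChart.kernel ↔ ReducesToZero` is the tree's
`mem_kernel_iff_reducesToZero` (`GoodReductionLangLift`). This file is the glue: additive reduction of
`M/ℤ_p` (`Δ, c₄ ∈ pℤ_p`, e.g. from Mathlib's `HasAdditiveReduction ℤ_[p]` of `M ⊗ ℚ_p`, e.g. from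
`Addv W p` for `M = W_ℤ ⊗ ℤ_p`) makes the `𝒪_K`-model cuspidal, `k̄⁺` is `p`-torsion, so `p • E₀(K) ⊆ E₁(K)`.
TOOL theorems only (no definition, no named fact, no `sorry`); closes nothing by itself; nothing booked.
NOT here: the SURJECTIVITY `E₀(K) → k⁺` (needs `𝒪_K` henselian and a `k`-rational cusp chart) and the
Galois-module identification `E₀(K)/E₁(K) ≅ k⁺` — the remaining inputs of kim3's consumer theorem (G7).

## What is proved (`𝒪 = unitBall K`, `M_K = M.map (coeffHom p K)`, `E = curveK p K M = M_K ⊗ K`,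
`E₀(K) = M_K.nonsingularReductionSubgroup hv`, `hv = Valuation.integer.integers (NormedField.valuation)`)

* §1 `𝒪_K`: `not_isUnit_of_norm_lt_one`, `residue_eq_zero_of_norm_lt_one`, `natCast_prime_residueField_eq_zero`
  (`p = 0` in `k` and in `k̄`), `baseChange_map_coeffHom` (`M_K ⊗ K = curveK p K M`, `rfl`),
  `mem_kernel_iff_reducesToZero_curveK`, `kernel_le_nonsingularReductionSubgroup` (`E₁(K) ⊆ E₀(K)`).
* §2 additive reduction: `norm_Δ_lt_one_of_hasAdditiveReduction` (`‖Δ‖, ‖c₄‖ < 1` from Mathlib's class on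
  `M ⊗ ℚ_p`), `residue_Δ_map_coeffHom_eq_zero` / `…c₄…` (the `𝒪_K`-model is cuspidal),
  **`prime_nsmul_mem_kernel_of_mem_nonsingularReductionSubgroup`** (`p • E₀(K) ⊆ E₁(K)`),
  **`nonsingularReductionSubgroup_le_satKernel`** (`E₀(K) ⊆ Ẽ₁(K)`: `Λ̃` is defined and additive on `E₀(K)`).
* §3 `M = W_ℤ ⊗ ℤ_p`, `Addv W p`, unramified `K`: `norm_Δ_lt_one_of_addv`,
  **`norm_satLog_le_one_of_mem_nonsingularReductionSubgroup_of_addv`** — `‖Λ̃(Q)‖ ≤ 1` for every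
  `Q ∈ E₀(K)`, the second clause of kim3's CONSUMER THEOREM.

References: J. H. Silverman, *The Arithmetic of Elliptic Curves*, 2nd ed. (2009), Prop. VII.2.1, VII.2.2,
III.2.5 (`Ẽ_ns ≅ 𝔾_a` at a cusp), IV.6.4 [SilvermanAEC2009]; kim3 brief HOME/kim3/KIM3-KPORT-BRIEF-g12.md §3.
-/

noncomputable section

-- the cell's Theorems namespace `Summit.BirchSwinnertonDyer.BirchSwinnertonDyer.…` repeats the summit name by design (D-0017)
set_option linter.dupNamespace false

open scoped Classical

namespace Summit.BirchSwinnertonDyer.BirchSwinnertonDyer.Theorems.KPort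

open Summit.BirchSwinnertonDyer.Rank1Residual.Additive
open Summit.BirchSwinnertonDyer.Rank1Residual.Additive.BallEval
open Literature.NumberTheory.GaloisRepresentations.LubinTate (unitBall mem_unitBall_iff)
open Literature.NumberTheory.EllipticCurves Literature.NumberTheory.EllipticCurves.FormalGroupChart
open Literature.NumberTheory.EllipticCurves.Rank1Residual WeierstrassCurve

variable {p : ℕ} [hp : Fact p.Prime] {K : Type*} [NontriviallyNormedField K] [NormedAlgebra ℚ_[p] K]
  [IsUltrametricDist K]

/-! ## §1 The valuation ring `𝒪_K`, its residue field, and the two renderings of `E₁(K)` -/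

section Ring

omit [NormedAlgebra ℚ_[p] K] hp in
/-- An element of `𝒪_K` of norm `< 1` is not a unit. [folklore] -/
theorem not_isUnit_of_norm_lt_one {x : unitBall K} (hx : ‖(x : K)‖ < 1) : ¬ IsUnit x := by
  intro hu
  have h1 := Valuation.Integers.one_of_isUnit (Valuation.integer.integers (NormedField.valuation (K := K))) hu
  rw [← NNReal.coe_inj, NormedField.valuation_apply, coe_nnnorm, NNReal.coe_one] at h1
  exact hx.ne h1

omit [NormedAlgebra ℚ_[p] K] hp in
/-- An element of `𝒪_K` of norm `< 1` reduces to `0` in the residue field `k = 𝒪_K/𝔪_K`. [folklore] -/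
theorem residue_eq_zero_of_norm_lt_one {x : unitBall K} (hx : ‖(x : K)‖ < 1) :
    IsLocalRing.residue (unitBall K) x = 0 := by
  rw [IsLocalRing.residue_eq_zero_iff, IsLocalRing.mem_maximalIdeal, mem_nonunits_iff]
  exact not_isUnit_of_norm_lt_one hx

/-- **`p = 0` in the residue field `k` of `𝒪_K`** (`‖p‖ = p⁻¹ < 1`): `k` has characteristic `p`. [folklore] -/
theorem natCast_prime_residueField_eq_zero :
    ((p : ℕ) : IsLocalRing.ResidueField (unitBall K)) = 0 := by
  rw [← map_natCast (IsLocalRing.residue (unitBall K)) p]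
  refine residue_eq_zero_of_norm_lt_one ?_
  rw [show ((p : unitBall K) : K) = (p : K) from by simp]
  exact (norm_p_pos_lt (p := p) (K := K)).2

/-- `p = 0` in `k̄`. [folklore] -/
theorem natCast_prime_algebraicClosure_residueField_eq_zero :
    ((p : ℕ) : AlgebraicClosure (IsLocalRing.ResidueField (unitBall K))) = 0 := by
  rw [← map_natCast (algebraMap (IsLocalRing.ResidueField (unitBall K)) _) p,
    natCast_prime_residueField_eq_zero, map_zero]

variable {M : WeierstrassCurve ℤ_[p]}

variable (p K M) in
/-- `curveK p K M` IS the base change of the `𝒪_K`-model `M.map (coeffHom p K)` (definitionally), so the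
tree's `ReductionHomomorphism` (`E₀`, `E₁`, `reducePoint`) speaks about its points. [folklore] -/
theorem baseChange_map_coeffHom : (M.map (coeffHom p K)).baseChange K = curveK p K M := rfl

/-- **The two renderings of `E₁(K)` agree**: `FormalGroupChart.kernel` (x1b, `‖x‖ > 1`) `↔`
`WeierstrassCurve.ReducesToZero` of the `𝒪_K`-model (the tree's bridge `mem_kernel_iff_reducesToZero`).
[cite: SilvermanAEC2009, Prop. VII.2.1 and VII.2.2] -/
theorem mem_kernel_iff_reducesToZero_curveK [(curveK p K M).IsIntegral (NormedField.valuation (K := K)).integer]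
    (P : (curveK p K M).toAffine.Point) :
    P ∈ kernel (NormedField.valuation (K := K)) (curveK p K M) ↔ (M.map (coeffHom p K)).ReducesToZero P :=
  mem_kernel_iff_reducesToZero (M.map (coeffHom p K)) P

/-- `E₁(K) ⊆ E₀(K)`. [cite: SilvermanAEC2009, Prop. VII.2.1] -/
theorem kernel_le_nonsingularReductionSubgroup [(curveK p K M).IsIntegral (NormedField.valuation (K := K)).integer] :
    kernel (NormedField.valuation (K := K)) (curveK p K M) ≤
      (M.map (coeffHom p K)).nonsingularReductionSubgroup
        (Valuation.integer.integers (NormedField.valuation (K := K))) :=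
  fun P hP => ((mem_kernel_iff_reducesToZero_curveK P).mp hP).hasNonsingularReduction

end Ring

/-! ## §2 Additive reduction: the `𝒪_K`-model is cuspidal and `p • E₀(K) ⊆ E₁(K)` -/

section AdditiveReduction

variable {M : WeierstrassCurve ℤ_[p]}

omit [NontriviallyNormedField K] [NormedAlgebra ℚ_[p] K] [IsUltrametricDist K] in
/-- `‖Δ(M)‖ < 1` and `‖c₄(M)‖ < 1` when the generic fibre `M ⊗ ℚ_p` has additive reduction in Mathlib's sense
(`valuation Δ < 1`, `valuation c₄ < 1`). [cite: SilvermanAEC2009, VII.5 Prop. 5.1] -/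
theorem norm_Δ_lt_one_of_hasAdditiveReduction [h : (M.map PadicInt.Coe.ringHom).HasAdditiveReduction ℤ_[p]] :
    ‖M.Δ‖ < 1 ∧ ‖M.c₄‖ < 1 := by
  have hΔ := h.badReduction
  have hc := h.additiveReduction
  rw [map_Δ] at hΔ
  rw [map_c₄] at hc
  change IsDedekindDomain.HeightOneSpectrum.valuation ℚ_[p] (IsDiscreteValuationRing.maximalIdeal ℤ_[p])
    (algebraMap ℤ_[p] ℚ_[p] M.Δ) < 1 at hΔ
  change IsDedekindDomain.HeightOneSpectrum.valuation ℚ_[p] (IsDiscreteValuationRing.maximalIdeal ℤ_[p])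
    (algebraMap ℤ_[p] ℚ_[p] M.c₄) < 1 at hc
  rw [IsDedekindDomain.HeightOneSpectrum.valuation_lt_one_iff_mem] at hΔ hc
  change M.Δ ∈ IsLocalRing.maximalIdeal ℤ_[p] at hΔ
  change M.c₄ ∈ IsLocalRing.maximalIdeal ℤ_[p] at hc
  rw [IsLocalRing.mem_maximalIdeal, PadicInt.mem_nonunits] at hΔ hc
  exact ⟨hΔ, hc⟩

/-- The `𝒪_K`-model of an additively reducing `M` is CUSPIDAL: `Δ̃ = 0`. [cite: SilvermanAEC2009, VII.5 Prop. 5.1] -/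
theorem residue_Δ_map_coeffHom_eq_zero (hΔ : ‖M.Δ‖ < 1) :
    IsLocalRing.residue (unitBall K) (M.map (coeffHom p K)).Δ = 0 := by
  rw [map_Δ]
  exact residue_eq_zero_of_norm_lt_one (by rw [norm_coe_coeffHom]; exact hΔ)

/-- … and `c̃₄ = 0`. [cite: SilvermanAEC2009, VII.5 Prop. 5.1] -/
theorem residue_c₄_map_coeffHom_eq_zero (hc₄ : ‖M.c₄‖ < 1) :
    IsLocalRing.residue (unitBall K) (M.map (coeffHom p K)).c₄ = 0 := by
  rw [map_c₄]
  exact residue_eq_zero_of_norm_lt_one (by rw [norm_coe_coeffHom]; exact hc₄)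

/-- **`p • E₀(K) ⊆ E₁(K)` at additive reduction** (`K ⊇ ℚ_p` complete ultrametric, any `M/ℤ_p` with
`Δ, c₄ ∈ pℤ_p`): the tree's cusp homomorphism `r : E₀(K) → k̄⁺` has kernel exactly `E₁(K)` and `k̄⁺` is
`p`-torsion, so `r(p • P) = p · r(P) = 0`. [cite: SilvermanAEC2009, Prop. VII.2.1 and III.2.5] -/
theorem prime_nsmul_mem_kernel_of_mem_nonsingularReductionSubgroup
    [(curveK p K M).IsIntegral (NormedField.valuation (K := K)).integer]
    (hΔ : ‖M.Δ‖ < 1) (hc₄ : ‖M.c₄‖ < 1) {P : (curveK p K M).toAffine.Point}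
    (hP : P ∈ (M.map (coeffHom p K)).nonsingularReductionSubgroup
      (Valuation.integer.integers (NormedField.valuation (K := K)))) :
    p • P ∈ kernel (NormedField.valuation (K := K)) (curveK p K M) := by
  obtain ⟨r, hr⟩ := (M.map (coeffHom p K)).exists_addMonoidHom_residueField_of_cusp
    (Valuation.integer.integers (NormedField.valuation (K := K)))
    (residue_Δ_map_coeffHom_eq_zero hΔ) (residue_c₄_map_coeffHom_eq_zero hc₄)
  have hpP : p • P ∈ (M.map (coeffHom p K)).nonsingularReductionSubgroup
      (Valuation.integer.integers (NormedField.valuation (K := K))) := AddSubgroup.nsmul_mem _ hP p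
  have h0 : r ⟨p • P, hpP⟩ = 0 := by
    have e : (⟨p • P, hpP⟩ : (M.map (coeffHom p K)).nonsingularReductionSubgroup
        (Valuation.integer.integers (NormedField.valuation (K := K)))) = p • ⟨P, hP⟩ := rfl
    rw [e, map_nsmul, nsmul_eq_mul, natCast_prime_algebraicClosure_residueField_eq_zero, zero_mul]
  rw [mem_kernel_iff_reducesToZero_curveK]
  exact (hr _).mp h0

/-- **`E₀(K) ⊆ Ẽ₁(K)` at additive reduction**: the saturated logarithm `Λ̃` is defined (with `n = p`) and
additive on all of `E₀(K)`. [cite: SilvermanAEC2009, Prop. VII.2.1 and IV.6.4] -/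
theorem nonsingularReductionSubgroup_le_satKernel
    [(curveK p K M).IsIntegral (NormedField.valuation (K := K)).integer]
    (hΔ : ‖M.Δ‖ < 1) (hc₄ : ‖M.c₄‖ < 1) :
    (M.map (coeffHom p K)).nonsingularReductionSubgroup
        (Valuation.integer.integers (NormedField.valuation (K := K))) ≤ satKernel p K M :=
  fun _ hP => mem_satKernel_of_nsmul_mem hp.out.pos
    (prime_nsmul_mem_kernel_of_mem_nonsingularReductionSubgroup hΔ hc₄ hP)

/-- `Λ̃(Q) = Λ(p • Q)/p` on `E₀(K)` (additive reduction) — kim3's "`log P := L(3•P)/3`" shape, with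
`3 • E₀ ⊆ E₁` instead of `9 • E₀ ⊆ E⁽²⁾` (no `E⁽²⁾` is needed: `Λ` is additive on all of `E₁(K)`).
[cite: SilvermanAEC2009, IV.6.4 and Prop. VII.2.1] -/
theorem satLog_eq_ptLog_prime_nsmul_div [CompleteSpace K]
    [(curveK p K M).IsIntegral (NormedField.valuation (K := K)).integer] [(M.map PadicInt.Coe.ringHom).IsElliptic]
    (hΔ : ‖M.Δ‖ < 1) (hc₄ : ‖M.c₄‖ < 1) {Q : (curveK p K M).toAffine.Point}
    (hQ : Q ∈ (M.map (coeffHom p K)).nonsingularReductionSubgroup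
      (Valuation.integer.integers (NormedField.valuation (K := K)))) :
    satLog p K M Q = ptLog p K M (p • Q) / p :=
  satLog_eq_div hp.out.pos (prime_nsmul_mem_kernel_of_mem_nonsingularReductionSubgroup hΔ hc₄ hQ)

end AdditiveReduction

/-! ## §3 The minimal model of `W/ℚ` at an additive prime over an unramified `K`: `‖Λ̃‖ ≤ 1` on `E₀(K)` -/

section Addv

variable (W : WeierstrassCurve ℚ) [W.IsElliptic] [W.IsGloballyMinimal]

omit [NontriviallyNormedField K] [NormedAlgebra ℚ_[p] K] [IsUltrametricDist K] in
/-- `‖Δ‖ < 1` and `‖c₄‖ < 1` for `W_ℤ ⊗ ℤ_p` at an additive prime of the globally minimal `W` (n1011's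
`hasAdditiveReduction_baseChange_padic_of_addv` moved along `map_coe_integralModelInt`).
[cite: SilvermanAEC2009, VII.5 Prop. 5.1] -/
theorem norm_Δ_lt_one_of_addv (hadd : Addv W p) :
    ‖((integralModelInt W).map (Int.castRingHom ℤ_[p])).Δ‖ < 1 ∧
      ‖((integralModelInt W).map (Int.castRingHom ℤ_[p])).c₄‖ < 1 := by
  haveI : (((integralModelInt W).map (Int.castRingHom ℤ_[p])).map PadicInt.Coe.ringHom).HasAdditiveReduction
      ℤ_[p] := by
    rw [map_coe_integralModelInt]
    exact LocalLog.hasAdditiveReduction_baseChange_padic_of_addv W p hadd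
  exact norm_Δ_lt_one_of_hasAdditiveReduction

/-- **`p • E₀(K) ⊆ E₁(K)` for `W ⊗ K` at an additive prime `p` of `W`** (any complete ultrametric `K ⊇ ℚ_p`).
[cite: SilvermanAEC2009, Prop. VII.2.1 and III.2.5] -/
theorem prime_nsmul_mem_kernel_of_addv (hadd : Addv W p)
    [(curveK p K ((integralModelInt W).map (Int.castRingHom ℤ_[p]))).IsIntegral
      (NormedField.valuation (K := K)).integer]
    {P : (curveK p K ((integralModelInt W).map (Int.castRingHom ℤ_[p]))).toAffine.Point}
    (hP : P ∈ (((integralModelInt W).map (Int.castRingHom ℤ_[p])).map (coeffHom p K)).nonsingularReductionSubgroup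
      (Valuation.integer.integers (NormedField.valuation (K := K)))) :
    p • P ∈ kernel (NormedField.valuation (K := K))
      (curveK p K ((integralModelInt W).map (Int.castRingHom ℤ_[p]))) :=
  prime_nsmul_mem_kernel_of_mem_nonsingularReductionSubgroup (norm_Δ_lt_one_of_addv W hadd).1
    (norm_Δ_lt_one_of_addv W hadd).2 hP

/-- **`‖Λ̃(Q)‖ ≤ 1` for every `Q ∈ E₀(K)`** — `W/ℚ` globally minimal, `p` additive, `K ⊇ ℚ_p` complete
ultrametric and UNRAMIFIED (`‖x‖ < 1 ⇒ ‖x‖ ≤ ‖p‖`): the clause "`∀ Q ∈ E₀(K), ‖log Q‖ ≤ 1`" of kim3's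
CONSUMER THEOREM for SAT₀ (`p Λ̃(Q) = Λ(p • Q) ∈ Λ(E₁(K)) = p𝒪_K`).
[cite: SilvermanAEC2009, IV.6.4 and Prop. VII.2.1–2.2] -/
theorem norm_satLog_le_one_of_mem_nonsingularReductionSubgroup_of_addv [CompleteSpace K] (hadd : Addv W p)
    (hK : ∀ x : K, ‖x‖ < 1 → ‖x‖ ≤ ‖(p : K)‖)
    [(curveK p K ((integralModelInt W).map (Int.castRingHom ℤ_[p]))).IsIntegral
      (NormedField.valuation (K := K)).integer]
    {Q : (curveK p K ((integralModelInt W).map (Int.castRingHom ℤ_[p]))).toAffine.Point}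
    (hQ : Q ∈ (((integralModelInt W).map (Int.castRingHom ℤ_[p])).map (coeffHom p K)).nonsingularReductionSubgroup
      (Valuation.integer.integers (NormedField.valuation (K := K)))) :
    ‖satLog p K ((integralModelInt W).map (Int.castRingHom ℤ_[p])) Q‖ ≤ 1 :=
  norm_satLog_le_one_of_prime_nsmul_mem_of_addv W hadd hK (prime_nsmul_mem_kernel_of_addv W hadd hQ)

/-- `E₀(K) ⊆ Ẽ₁(K)` for `W ⊗ K` at an additive prime: `Λ̃` is an additive, Galois-equivariant map
`E₀(K) → 𝒪_K` (with `satLog_add`, `satLog_galois`, and the bound above). [cite: SilvermanAEC2009, Prop. VII.2.1] -/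
theorem nonsingularReductionSubgroup_le_satKernel_of_addv (hadd : Addv W p)
    [(curveK p K ((integralModelInt W).map (Int.castRingHom ℤ_[p]))).IsIntegral
      (NormedField.valuation (K := K)).integer] :
    (((integralModelInt W).map (Int.castRingHom ℤ_[p])).map (coeffHom p K)).nonsingularReductionSubgroup
        (Valuation.integer.integers (NormedField.valuation (K := K))) ≤
      satKernel p K ((integralModelInt W).map (Int.castRingHom ℤ_[p])) :=
  nonsingularReductionSubgroup_le_satKernel (norm_Δ_lt_one_of_addv W hadd).1 (norm_Δ_lt_one_of_addv W hadd).2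

end Addv

end Summit.BirchSwinnertonDyer.BirchSwinnertonDyer.Theorems.KPort

end
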